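import Mathlib
import Summits.CriticalPhenomena.CardyFormulaZ2.Theorems.CardyFlipRussoSquareFromVoronoiHubDefs
import Literature.Probability.Percolation.SitePaths

/-!
# Stub `stub_faithful` (K1), line `Sketch` of crux `SquareFromVoronoiHub` — Part 1:
# geometry of the centred square lattice `G_s`

Crux `Summit.CriticalPhenomena.CardyFormulaZ2.Theses.CardyFlipRusso.SquareFromVoronoiHub`
(stmt-CriticalPhenomena-6434), line `Sketch` (card `voronoi-blocks-on-fixed-gs`), stub
`stub_faithful` ("faithful discretisation at cell scale `δ^{1/4}`"); registered sub-goal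
`stub_faithful_part1`.  Deterministic geometry of `G_s = ℤ² ∪ (ℤ² + (½,½))` (`zGs`, `Gs` of the
line's Defs module), the input of Part 2 (the lattice shadow of a continuum): coordinates and
squared distances of the sites (`zGs_re_inl`, …, `zGs_injective`); the kinds of pairs
(`Gs_adj_inl_inl`, `Gs_adj_inl_inr`, `not_Gs_adj_inr_inr`; integer forms `Gs_adj_inl_inr_iff` —
a centre is adjacent to the four corners of its face —, `Gs_adj_inl_inl_iff` — `ℤ²` edges);
**covering radius `1/2`** (`exists_dist_zGs_le`, `exists_dist_mul_zGs_le`: the sites form the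
square lattice of mesh `√2/2` spanned by `(½,½)`, `(½,-½)`); local finiteness
(`finite_setOf_norm_zGs_le`, `finite_setOf_dist_mul_zGs_le`); and **the combinatorial core**
`eq_or_adj_or_exists_of_dist_le` (`…_dist_mul_le` at mesh `δ`): two sites within `1/2` of a
common point are equal, adjacent, or two face centres at distance `1` whose common point is the
midpoint of a `ℤ²` edge (parallelogram law, `two_mul_eq_add_of_dist`), within `1/2` of a corner
adjacent to both — so the triangulation `G_s` shadows planar continua although centre–centre
pairs are not edges.
-/

noncomputable section

namespace Summit.CriticalPhenomena.CardyFormulaZ2.Cruxes.SquareFromVoronoiHub.VoronoiBlocks.Faithful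

open Set Metric

/-! ### Coordinates of the sites of `G_s` -/

/-- Real part of a corner site `(i, j) ∈ ℤ²`: `i`. [folklore] -/
@[simp] theorem zGs_re_inl (x : ℤ × ℤ) : (zGs (Sum.inl x)).re = x.1 := by
  simp [zGs]

/-- Imaginary part of a corner site `(i, j) ∈ ℤ²`: `j`. [folklore] -/
@[simp] theorem zGs_im_inl (x : ℤ × ℤ) : (zGs (Sum.inl x)).im = x.2 := by
  simp [zGs]

/-- Real part of a face-centre site `(i, j) + (½,½)`: `i + 1/2`. [folklore] -/
@[simp] theorem zGs_re_inr (f : ℤ × ℤ) : (zGs (Sum.inr f)).re = f.1 + 1 / 2 := by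
  simp [zGs]

/-- Imaginary part of a face-centre site `(i, j) + (½,½)`: `j + 1/2`. [folklore] -/
@[simp] theorem zGs_im_inr (f : ℤ × ℤ) : (zGs (Sum.inr f)).im = f.2 + 1 / 2 := by
  simp [zGs]

/-- Squared distance between two corner sites. [folklore] -/
theorem dist_sq_inl_inl (x y : ℤ × ℤ) :
    dist (zGs (Sum.inl x)) (zGs (Sum.inl y)) ^ 2 = ((x.1 - y.1 : ℤ) : ℝ) ^ 2 + ((x.2 - y.2 : ℤ) : ℝ) ^ 2 := by
  rw [Complex.dist_eq, Complex.sq_norm, Complex.normSq_apply, Complex.sub_re, Complex.sub_im]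
  push_cast; simp; ring

/-- Squared distance between a corner site and a face centre. [folklore] -/
theorem dist_sq_inl_inr (x f : ℤ × ℤ) :
    dist (zGs (Sum.inl x)) (zGs (Sum.inr f)) ^ 2 =
      (((x.1 - f.1 : ℤ) : ℝ) - 1 / 2) ^ 2 + (((x.2 - f.2 : ℤ) : ℝ) - 1 / 2) ^ 2 := by
  rw [Complex.dist_eq, Complex.sq_norm, Complex.normSq_apply, Complex.sub_re, Complex.sub_im]
  push_cast; simp; ring

/-- Squared distance between two face centres. [folklore] -/
theorem dist_sq_inr_inr (f g : ℤ × ℤ) :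
    dist (zGs (Sum.inr f)) (zGs (Sum.inr g)) ^ 2 = ((f.1 - g.1 : ℤ) : ℝ) ^ 2 + ((f.2 - g.2 : ℤ) : ℝ) ^ 2 := by
  rw [Complex.dist_eq, Complex.sq_norm, Complex.normSq_apply, Complex.sub_re, Complex.sub_im]
  push_cast; simp; ring

/-- The site map `zGs` is injective. [folklore] -/
theorem zGs_injective : Function.Injective zGs := by
  rintro (x | f) (y | g) h
  · have h1 := congrArg Complex.re h
    have h2 := congrArg Complex.im h
    simp only [zGs_re_inl, zGs_im_inl, Int.cast_inj] at h1 h2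
    rw [Prod.ext h1 h2]
  · have h1 := congrArg Complex.re h
    simp only [zGs_re_inl, zGs_re_inr] at h1
    have : (2 * x.1 : ℤ) = 2 * g.1 + 1 := by exact_mod_cast (by linarith : (2 * x.1 : ℝ) = 2 * g.1 + 1)
    omega
  · have h1 := congrArg Complex.re h
    simp only [zGs_re_inl, zGs_re_inr] at h1
    have : (2 * f.1 + 1 : ℤ) = 2 * y.1 := by exact_mod_cast (by linarith : (2 * f.1 + 1 : ℝ) = 2 * y.1)
    omega
  · have h1 := congrArg Complex.re h
    have h2 := congrArg Complex.im h
    simp only [zGs_re_inr, zGs_im_inr, add_left_inj, Int.cast_inj] at h1 h2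
    rw [Prod.ext h1 h2]

/-! ### The three kinds of pairs of `G_s` -/

/-- Two corners are adjacent iff they are at distance `1` (an edge of `ℤ²`). [folklore] -/
theorem Gs_adj_inl_inl {x y : ℤ × ℤ} :
    Gs.Adj (Sum.inl x) (Sum.inl y) ↔ dist (zGs (Sum.inl x)) (zGs (Sum.inl y)) = 1 := by
  simp only [Gs, SimpleGraph.fromRel_adj, ne_eq, Sum.isLeft_inl, Sum.isRight_inl, true_and,
    Bool.false_eq_true, false_and, or_false]
  constructor
  · rintro ⟨-, h | h⟩
    · exact h
    · rwa [dist_comm]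
  · intro h
    refine ⟨fun hxy => ?_, Or.inl h⟩
    rw [hxy, dist_self] at h
    exact zero_ne_one h

/-- A corner and a face centre are adjacent iff they are at distance `< 1`. [folklore] -/
theorem Gs_adj_inl_inr {x f : ℤ × ℤ} :
    Gs.Adj (Sum.inl x) (Sum.inr f) ↔ dist (zGs (Sum.inl x)) (zGs (Sum.inr f)) < 1 := by
  simp only [Gs, SimpleGraph.fromRel_adj, ne_eq, Sum.isLeft_inl, Sum.isRight_inr, Sum.isLeft_inr,
    Sum.isRight_inl, true_and, Bool.false_eq_true, false_and, or_false, false_or,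
    reduceCtorEq, not_false_eq_true]

/-- Two face centres are never adjacent. [folklore] -/
theorem not_Gs_adj_inr_inr (f g : ℤ × ℤ) : ¬ Gs.Adj (Sum.inr f) (Sum.inr g) := by
  simp [Gs, SimpleGraph.fromRel_adj]

/-- An integer `a` with `(a - 1/2)² < 9/4` (as a real) is `0` or `1`. [folklore] -/
private theorem int_eq_zero_or_one_of_sq_lt {a : ℤ} (h : ((a : ℝ) - 1 / 2) ^ 2 < 9 / 4) :
    a = 0 ∨ a = 1 := by
  have h1 : (a : ℝ) < 2 := by nlinarith
  have h2 : (-1 : ℝ) < a := by nlinarith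
  have h1' : a < 2 := by exact_mod_cast h1
  have h2' : -1 < a := by exact_mod_cast h2
  omega

/-- **Integer form of the centre–corner adjacency**: the corner `(x₁, x₂)` is adjacent to the face
centre `(f₁, f₂) + (½,½)` iff it is one of the four corners of that face, `xᵢ - fᵢ ∈ {0, 1}`. [folklore] -/
theorem Gs_adj_inl_inr_iff {x f : ℤ × ℤ} :
    Gs.Adj (Sum.inl x) (Sum.inr f) ↔ (x.1 - f.1 = 0 ∨ x.1 - f.1 = 1) ∧ (x.2 - f.2 = 0 ∨ x.2 - f.2 = 1) := by
  rw [Gs_adj_inl_inr, ← sq_lt_one_iff₀ dist_nonneg, dist_sq_inl_inr]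
  constructor
  · intro h
    have ha := sq_nonneg (((x.1 - f.1 : ℤ) : ℝ) - 1 / 2)
    have hb := sq_nonneg (((x.2 - f.2 : ℤ) : ℝ) - 1 / 2)
    exact ⟨int_eq_zero_or_one_of_sq_lt (by linarith), int_eq_zero_or_one_of_sq_lt (by linarith)⟩
  · rintro ⟨h1 | h1, h2 | h2⟩ <;> rw [h1, h2] <;> norm_num

/-- **Integer form of the corner–corner adjacency**: an edge of `ℤ²`. [folklore] -/
theorem Gs_adj_inl_inl_iff {x y : ℤ × ℤ} :
    Gs.Adj (Sum.inl x) (Sum.inl y) ↔ (x.1 - y.1) ^ 2 + (x.2 - y.2) ^ 2 = 1 := by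
  rw [Gs_adj_inl_inl, ← pow_eq_one_iff_of_nonneg dist_nonneg two_ne_zero, dist_sq_inl_inl]
  exact_mod_cast Iff.rfl

/-! ### Covering radius and local finiteness -/

/-- **Covering radius `1/2`**: every point of the plane is within `1/2` of a site of `G_s` (round
the rotated coordinates `re + im`, `re - im` to integers `m`, `n`; the site with doubled
coordinates `(m + n, m - n)` is a corner or a centre according to the parity of `m + n`). [folklore] -/
theorem exists_dist_zGs_le (p : ℂ) : ∃ v, dist p (zGs v) ≤ 1 / 2 := by
  set m : ℤ := round (p.re + p.im) with hm
  set n : ℤ := round (p.re - p.im) with hn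
  have hα : |p.re + p.im - m| ≤ 1 / 2 := abs_sub_round _
  have hβ : |p.re - p.im - n| ≤ 1 / 2 := abs_sub_round _
  -- a site `v` with `re = (m+n)/2`, `im = (m-n)/2`
  obtain ⟨v, hre, him⟩ : ∃ v, (zGs v).re = ((m : ℝ) + n) / 2 ∧ (zGs v).im = ((m : ℝ) - n) / 2 := by
    rcases Int.even_or_odd' (m + n) with ⟨k, hk | hk⟩
    · refine ⟨Sum.inl (k, k - n), ?_, ?_⟩
      · rw [zGs_re_inl]
        have : ((m + n : ℤ) : ℝ) = ((2 * k : ℤ) : ℝ) := by rw [hk]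
        push_cast at this ⊢; linarith
      · rw [zGs_im_inl]
        have : ((m + n : ℤ) : ℝ) = ((2 * k : ℤ) : ℝ) := by rw [hk]
        push_cast at this ⊢; linarith
    · refine ⟨Sum.inr (k, k - n), ?_, ?_⟩
      · rw [zGs_re_inr]
        have : ((m + n : ℤ) : ℝ) = ((2 * k + 1 : ℤ) : ℝ) := by rw [hk]
        push_cast at this ⊢; linarith
      · rw [zGs_im_inr]
        have : ((m + n : ℤ) : ℝ) = ((2 * k + 1 : ℤ) : ℝ) := by rw [hk]
        push_cast at this ⊢; linarith
  refine ⟨v, ?_⟩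
  rw [← pow_le_pow_iff_left₀ dist_nonneg (by norm_num) two_ne_zero, Complex.dist_eq, Complex.sq_norm,
    Complex.normSq_apply, Complex.sub_re, Complex.sub_im, hre, him]
  have e : (p.re - ((m : ℝ) + n) / 2) * (p.re - ((m : ℝ) + n) / 2) +
      (p.im - ((m : ℝ) - n) / 2) * (p.im - ((m : ℝ) - n) / 2) =
      ((p.re + p.im - m) ^ 2 + (p.re - p.im - n) ^ 2) / 2 := by ring
  rw [e]
  have h1 : (p.re + p.im - m) ^ 2 ≤ (1 / 2) ^ 2 := by
    rw [← sq_abs]; exact pow_le_pow_left₀ (abs_nonneg _) hα 2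
  have h2 : (p.re - p.im - n) ^ 2 ≤ (1 / 2) ^ 2 := by
    rw [← sq_abs]; exact pow_le_pow_left₀ (abs_nonneg _) hβ 2
  linarith

/-- Scaling of distances to sites of `δ • G_s`. [folklore] -/
theorem dist_mul_zGs (δ : ℝ) (p : ℂ) (v : (ℤ × ℤ) ⊕ (ℤ × ℤ)) :
    dist ((δ : ℂ) * p) ((δ : ℂ) * zGs v) = |δ| * dist p (zGs v) := by
  rw [Complex.dist_eq, Complex.dist_eq, ← mul_sub, norm_mul, Complex.norm_real, Real.norm_eq_abs]

/-- **Covering radius `δ/2` at mesh `δ`**: every point is within `δ/2` of a site of `δ • G_s`. [folklore] -/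
theorem exists_dist_mul_zGs_le {δ : ℝ} (hδ : 0 < δ) (p : ℂ) :
    ∃ v, dist p ((δ : ℂ) * zGs v) ≤ δ / 2 := by
  obtain ⟨v, hv⟩ := exists_dist_zGs_le (p / δ)
  refine ⟨v, ?_⟩
  have hp : (δ : ℂ) * (p / δ) = p := by
    have : (δ : ℂ) ≠ 0 := Complex.ofReal_ne_zero.mpr hδ.ne'
    field_simp
  rw [← hp, dist_mul_zGs, abs_of_pos hδ]
  nlinarith

/-- The sites of `G_s` in a bounded region are finitely many (their integer coordinates are
bounded). [folklore] -/
theorem finite_setOf_norm_zGs_le (r : ℝ) : {v : (ℤ × ℤ) ⊕ (ℤ × ℤ) | ‖zGs v‖ ≤ r}.Finite := by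
  set N : ℕ := ⌈r⌉₊ + 1 with hN
  have hrN : r + 1 / 2 ≤ N := by
    have := Nat.le_ceil r
    rw [hN]; push_cast; linarith
  set box : Set (ℤ × ℤ) := Icc (-(N : ℤ)) N ×ˢ Icc (-(N : ℤ)) N with hbox
  have hboxf : box.Finite := (finite_Icc _ _).prod (finite_Icc _ _)
  refine ((hboxf.image Sum.inl).union (hboxf.image Sum.inr)).subset ?_
  -- a real number of absolute value `≤ N` casts from an integer in `[-N, N]`
  have key : ∀ a : ℤ, |(a : ℝ)| ≤ N → a ∈ Icc (-(N : ℤ)) N := by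
    intro a ha
    obtain ⟨h1, h2⟩ := abs_le.mp ha
    constructor
    · exact_mod_cast h1
    · exact_mod_cast h2
  rintro (x | f) hv
  · have hre := (Complex.abs_re_le_norm (zGs (Sum.inl x))).trans hv
    have him := (Complex.abs_im_le_norm (zGs (Sum.inl x))).trans hv
    rw [zGs_re_inl] at hre
    rw [zGs_im_inl] at him
    exact Or.inl ⟨x, ⟨key _ (by linarith), key _ (by linarith)⟩, rfl⟩
  · have hre := (Complex.abs_re_le_norm (zGs (Sum.inr f))).trans hv
    have him := (Complex.abs_im_le_norm (zGs (Sum.inr f))).trans hv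
    rw [zGs_re_inr] at hre
    rw [zGs_im_inr] at him
    have h1 : |(f.1 : ℝ)| ≤ N := by
      have := abs_add_le (f.1 + 1 / 2 : ℝ) (-(1 / 2))
      rw [add_neg_cancel_right, abs_neg, abs_of_pos (by norm_num : (0 : ℝ) < 1 / 2)] at this
      linarith
    have h2 : |(f.2 : ℝ)| ≤ N := by
      have := abs_add_le (f.2 + 1 / 2 : ℝ) (-(1 / 2))
      rw [add_neg_cancel_right, abs_neg, abs_of_pos (by norm_num : (0 : ℝ) < 1 / 2)] at this
      linarith
    exact Or.inr ⟨f, ⟨key _ h1, key _ h2⟩, rfl⟩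

/-- Finitely many sites of `δ • G_s` (`δ > 0`) lie within a given distance of a point. [folklore] -/
theorem finite_setOf_dist_mul_zGs_le {δ : ℝ} (hδ : 0 < δ) (p : ℂ) (r : ℝ) :
    {v : (ℤ × ℤ) ⊕ (ℤ × ℤ) | dist p ((δ : ℂ) * zGs v) ≤ r}.Finite := by
  refine (finite_setOf_norm_zGs_le (‖p / δ‖ + r / δ)).subset fun v hv => ?_
  have hp : (δ : ℂ) * (p / δ) = p := by
    have : (δ : ℂ) ≠ 0 := Complex.ofReal_ne_zero.mpr hδ.ne'
    field_simp
  have hv' : dist (p / δ) (zGs v) ≤ r / δ := by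
    rw [le_div_iff₀ hδ]
    have := hv
    rw [mem_setOf_eq, ← hp, dist_mul_zGs, abs_of_pos hδ] at this
    linarith
  calc ‖zGs v‖ = dist (zGs v) 0 := (dist_zero_right _).symm
    _ ≤ dist (zGs v) (p / δ) + dist (p / δ) 0 := dist_triangle _ _ _
    _ ≤ r / δ + ‖p / δ‖ := by rw [dist_comm, dist_zero_right]; exact add_le_add hv' le_rfl
    _ = ‖p / δ‖ + r / δ := add_comm _ _

/-! ### The combinatorial core: two sites near a common point -/

/-- Two points at distance `1` whose closed `1/2`-balls share a point share only the midpoint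
(parallelogram law). [folklore] -/
theorem two_mul_eq_add_of_dist {p a b : ℂ} (hab : dist a b = 1) (ha : dist p a ≤ 1 / 2)
    (hb : dist p b ≤ 1 / 2) : 2 * p = a + b := by
  rw [Complex.dist_eq] at hab ha hb
  have key := parallelogram_law_with_norm ℝ (2 * p - a - b) (a - b)
  have e1 : 2 * p - a - b + (a - b) = 2 * (p - b) := by ring
  have e2 : 2 * p - a - b - (a - b) = 2 * (p - a) := by ring
  rw [e1, e2, norm_mul, norm_mul, Complex.norm_two, hab] at key
  have h0 : ‖2 * p - a - b‖ ^ 2 ≤ 0 := by nlinarith [norm_nonneg (p - a), norm_nonneg (p - b)]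
  have h1 : ‖2 * p - a - b‖ = 0 := by nlinarith [norm_nonneg (2 * p - a - b)]
  rw [norm_eq_zero] at h1
  linear_combination h1

/-- Integers with `a² + b² ≤ 1`. [folklore] -/
private theorem int_sq_add_sq_le_one {a b : ℤ} (h : a ^ 2 + b ^ 2 ≤ 1) :
    (a = 0 ∧ b = 0) ∨ ((a = 1 ∨ a = -1) ∧ b = 0) ∨ (a = 0 ∧ (b = 1 ∨ b = -1)) := by
  have ha : a ^ 2 ≤ 1 := by nlinarith [sq_nonneg b]
  have hb : b ^ 2 ≤ 1 := by nlinarith [sq_nonneg a]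
  have ha1 : -1 ≤ a ∧ a ≤ 1 := by constructor <;> nlinarith
  have hb1 : -1 ≤ b ∧ b ≤ 1 := by constructor <;> nlinarith
  obtain ⟨ha1, ha2⟩ := ha1
  obtain ⟨hb1, hb2⟩ := hb1
  interval_cases a <;> interval_cases b <;> simp_all

/-- The centre–centre case of the core lemma, for the two "positive" unit offsets: the face
centres `f` and `f + (1,0)` (resp. `f + (0,1)`) have the corner `f + (1,0)` (resp. `f + (0,1)`)
adjacent to both and at distance `1/2` from the midpoint. [folklore] -/
private theorem exists_corner_of_inr_inr {f g : ℤ × ℤ} (h : (g.1 = f.1 + 1 ∧ g.2 = f.2) ∨ (g.1 = f.1 ∧ g.2 = f.2 + 1))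
    {p : ℂ} (hp : 2 * p = zGs (Sum.inr f) + zGs (Sum.inr g)) :
    ∃ c, Gs.Adj (Sum.inr f) c ∧ Gs.Adj c (Sum.inr g) ∧ dist p (zGs c) ≤ 1 / 2 := by
  have hre : p.re = ((f.1 : ℝ) + 1 / 2 + (g.1 + 1 / 2)) / 2 := by
    have := congrArg Complex.re hp; simp at this; norm_num at this; linarith
  have him : p.im = ((f.2 : ℝ) + 1 / 2 + (g.2 + 1 / 2)) / 2 := by
    have := congrArg Complex.im hp; simp at this; norm_num at this; linarith
  rcases h with ⟨h1, h2⟩ | ⟨h1, h2⟩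
  · refine ⟨Sum.inl (f.1 + 1, f.2), ?_, ?_, ?_⟩
    · rw [Gs.adj_comm, Gs_adj_inl_inr_iff]; omega
    · rw [Gs_adj_inl_inr_iff]; omega
    · rw [← pow_le_pow_iff_left₀ dist_nonneg (by norm_num) two_ne_zero, Complex.dist_eq, Complex.sq_norm,
        Complex.normSq_apply, Complex.sub_re, Complex.sub_im, hre, him, zGs_re_inl, zGs_im_inl, h1, h2]
      push_cast; ring_nf; norm_num
  · refine ⟨Sum.inl (f.1, f.2 + 1), ?_, ?_, ?_⟩
    · rw [Gs.adj_comm, Gs_adj_inl_inr_iff]; omega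
    · rw [Gs_adj_inl_inr_iff]; omega
    · rw [← pow_le_pow_iff_left₀ dist_nonneg (by norm_num) two_ne_zero, Complex.dist_eq, Complex.sq_norm,
        Complex.normSq_apply, Complex.sub_re, Complex.sub_im, hre, him, zGs_re_inl, zGs_im_inl, h1, h2]
      push_cast; ring_nf; norm_num

/-- **The combinatorial core.**  Two sites of `G_s` within `1/2` of a common point `p` are equal,
or adjacent, or (two face centres at distance `1`, `p` the midpoint of the `ℤ²` edge between
them) have a common neighbour — a corner — within `1/2` of `p`. [folklore] -/
theorem eq_or_adj_or_exists_of_dist_le {u w : (ℤ × ℤ) ⊕ (ℤ × ℤ)} {p : ℂ}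
    (hu : dist p (zGs u) ≤ 1 / 2) (hw : dist p (zGs w) ≤ 1 / 2) :
    u = w ∨ Gs.Adj u w ∨ ∃ c, Gs.Adj u c ∧ Gs.Adj c w ∧ dist p (zGs c) ≤ 1 / 2 := by
  have hd : dist (zGs u) (zGs w) ≤ 1 := by
    calc dist (zGs u) (zGs w) ≤ dist (zGs u) p + dist p (zGs w) := dist_triangle _ _ _
      _ ≤ 1 / 2 + 1 / 2 := add_le_add (by rwa [dist_comm]) hw
      _ = 1 := by norm_num
  have hd2 : dist (zGs u) (zGs w) ^ 2 ≤ 1 := pow_le_one₀ dist_nonneg hd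
  rcases u with x | f <;> rcases w with y | g
  · -- two corners: equal or an edge of `ℤ²`
    rw [dist_sq_inl_inl] at hd2
    have h' : (x.1 - y.1) ^ 2 + (x.2 - y.2) ^ 2 ≤ 1 := by exact_mod_cast hd2
    rcases int_sq_add_sq_le_one h' with ⟨h1, h2⟩ | ⟨h1, h2⟩ | ⟨h1, h2⟩
    · left
      rw [show x = y from Prod.ext (by omega) (by omega)]
    · right; left
      rw [Gs_adj_inl_inl_iff, h2]
      rcases h1 with h1 | h1 <;> rw [h1] <;> norm_num
    · right; left
      rw [Gs_adj_inl_inl_iff, h1]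
      rcases h2 with h2 | h2 <;> rw [h2] <;> norm_num
  · -- a corner and a centre within distance `1`: adjacent
    right; left
    rw [Gs_adj_inl_inr_iff]
    rw [dist_sq_inl_inr] at hd2
    have ha := sq_nonneg (((x.1 - g.1 : ℤ) : ℝ) - 1 / 2)
    have hb := sq_nonneg (((x.2 - g.2 : ℤ) : ℝ) - 1 / 2)
    exact ⟨int_eq_zero_or_one_of_sq_lt (by linarith), int_eq_zero_or_one_of_sq_lt (by linarith)⟩
  · right; left
    rw [Gs.adj_comm, Gs_adj_inl_inr_iff]
    rw [dist_comm, dist_sq_inl_inr] at hd2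
    have ha := sq_nonneg (((y.1 - f.1 : ℤ) : ℝ) - 1 / 2)
    have hb := sq_nonneg (((y.2 - f.2 : ℤ) : ℝ) - 1 / 2)
    exact ⟨int_eq_zero_or_one_of_sq_lt (by linarith), int_eq_zero_or_one_of_sq_lt (by linarith)⟩
  · -- two centres: equal, or at distance `1` with `p` the midpoint of an `ℤ²` edge
    rw [dist_sq_inr_inr] at hd2
    have h' : (f.1 - g.1) ^ 2 + (f.2 - g.2) ^ 2 ≤ 1 := by exact_mod_cast hd2
    have hmid : ∀ {f g : ℤ × ℤ}, (f.1 - g.1) ^ 2 + (f.2 - g.2) ^ 2 = 1 →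
        dist p (zGs (Sum.inr f)) ≤ 1 / 2 → dist p (zGs (Sum.inr g)) ≤ 1 / 2 →
        2 * p = zGs (Sum.inr f) + zGs (Sum.inr g) := by
      intro f g hfg hf hg
      refine two_mul_eq_add_of_dist ?_ hf hg
      rw [← pow_eq_one_iff_of_nonneg dist_nonneg two_ne_zero, dist_sq_inr_inr]
      exact_mod_cast hfg
    rcases int_sq_add_sq_le_one h' with ⟨h1, h2⟩ | ⟨h1 | h1, h2⟩ | ⟨h1, h2 | h2⟩
    · left
      rw [show f = g from Prod.ext (by omega) (by omega)]
    · -- `g = f - (1,0)`: swap the roles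
      right; right
      have hp := hmid (f := g) (g := f) (by rw [← h'.antisymm (by nlinarith)]; ring) hw hu
      obtain ⟨c, h3, h4, h5⟩ := exists_corner_of_inr_inr (f := g) (g := f) (Or.inl ⟨by omega, by omega⟩) hp
      exact ⟨c, h4.symm, h3.symm, h5⟩
    · right; right
      have hp := hmid (f := f) (g := g) (by nlinarith) hu hw
      exact exists_corner_of_inr_inr (Or.inl ⟨by omega, by omega⟩) hp
    · right; right
      have hp := hmid (f := g) (g := f) (by nlinarith) hw hu
      obtain ⟨c, h3, h4, h5⟩ := exists_corner_of_inr_inr (f := g) (g := f) (Or.inr ⟨by omega, by omega⟩) hp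
      exact ⟨c, h4.symm, h3.symm, h5⟩
    · right; right
      have hp := hmid (f := f) (g := g) (by nlinarith) hu hw
      exact exists_corner_of_inr_inr (Or.inr ⟨by omega, by omega⟩) hp

/-- The core lemma at mesh `δ > 0`. [folklore] -/
theorem eq_or_adj_or_exists_of_dist_mul_le {δ : ℝ} (hδ : 0 < δ) {u w : (ℤ × ℤ) ⊕ (ℤ × ℤ)} {p : ℂ}
    (hu : dist p ((δ : ℂ) * zGs u) ≤ δ / 2) (hw : dist p ((δ : ℂ) * zGs w) ≤ δ / 2) :
    u = w ∨ Gs.Adj u w ∨ ∃ c, Gs.Adj u c ∧ Gs.Adj c w ∧ dist p ((δ : ℂ) * zGs c) ≤ δ / 2 := by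
  have hp : (δ : ℂ) * (p / δ) = p := by
    have : (δ : ℂ) ≠ 0 := Complex.ofReal_ne_zero.mpr hδ.ne'
    field_simp
  have hsc : ∀ v, dist p ((δ : ℂ) * zGs v) ≤ δ / 2 ↔ dist (p / δ) (zGs v) ≤ 1 / 2 := by
    intro v
    rw [← hp, dist_mul_zGs, abs_of_pos hδ, hp]
    constructor <;> intro h <;> nlinarith
  rw [hsc] at hu hw
  rcases eq_or_adj_or_exists_of_dist_le hu hw with h | h | ⟨c, h1, h2, h3⟩
  · exact Or.inl h
  · exact Or.inr (Or.inl h)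
  · exact Or.inr (Or.inr ⟨c, h1, h2, (hsc c).2 h3⟩)

/-- **Registered sub-goal `stub_faithful_part1`** of `stub_faithful` (K1): the covering radius
`δ/2` of `δ • G_s` and the combinatorial core for two sites near a common point — the two inputs
of the lattice shadow of a continuum (Part 2). [folklore] -/
theorem stub_faithful_part1 : (∀ {δ : ℝ}, 0 < δ → ∀ p : ℂ, ∃ v : (ℤ × ℤ) ⊕ (ℤ × ℤ), dist p ((δ : ℂ) * zGs v) ≤ δ / 2) ∧ ∀ {u w : (ℤ × ℤ) ⊕ (ℤ × ℤ)} {p : ℂ}, dist p (zGs u) ≤ 1 / 2 → dist p (zGs w) ≤ 1 / 2 → u = w ∨ Gs.Adj u w ∨ ∃ c, Gs.Adj u c ∧ Gs.Adj c w ∧ dist p (zGs c) ≤ 1 / 2 :=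
  ⟨fun hδ p => exists_dist_mul_zGs_le hδ p, fun hu hw => eq_or_adj_or_exists_of_dist_le hu hw⟩

end Summit.CriticalPhenomena.CardyFormulaZ2.Cruxes.SquareFromVoronoiHub.VoronoiBlocks.Faithful

end
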